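/-
Copyright (c) 2026 the pub-hodgecm-mathlib formalisation cell (harness21).  Prover seat hodgecm-mathlib-F0P3a-p04 (g12), (F12) «κ-SIGNS OF THE FOUR REPRESENTATIVES»
(offer 2026-09-01 05:46:11Z to F0P3-p02 (g11)'s packaging FILE B; LEAD F0P3a-plan (g9) T8-51 (C) ∕ T8-71 (b); architect A-p06 (g26) HEAD 3 «=» 05:20:11Z).
-/
import Literature.NumberTheory.Rogawski1990.UnitFundamentalLemmaInertFlickerClasses
import Literature.NumberTheory.Rogawski1990.LocalStableClassesNonsplitKappa
import Literature.NumberTheory.Rogawski1990.FinExplicitTransferFactorGHRegular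
import HarnessLib

/-!
# The signs `κ_v(γ_H, tᵢ) = (+1, +1, −1, −1)` of Flicker's four representatives, from the frame data (values-abstract)
# (Flicker 1998 §2 Prop. 3, §5 p. 95 `Φ^κ = Φ(t₁) + Φ(t₂) − Φ(t₃) − Φ(t₄)`; Rogawski 1990 §4.3 (4.3.2), §3.5 Prop. 3.5.2 (c))

Topic `NumberTheory/Rogawski1990`; namespace `Literature.NumberTheory.Rogawski1990`.  THEOREMS ONLY (no definition, no instance, no notation, no named fact, no `sorry`);
kernel lane.  Cell `pub/hodgecm-mathlib`, crux H413 = `stmt-HodgeConjecture-24833`, road «D-N7-inert», MAP v3 (F12): the `hκ₁ … hκ₄` binders of ★ p841086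
`finsum_delta_mul_classOrbitalIntegral_eq_of_four_classes_of_values`, read off the FRAME DATA that ★ F0P3-p02's package `exists_four_matched_flicker_representatives`
(`UnitFundamentalLemmaInertFlickerRepresentatives`, FILE A) delivers — stated over that data as HYPOTHESES (no import of FILE A: the congruence `Tl` with
`ᵗσ(Tl) Φ₃ Tl = H′_v`, the frame `P = Tl⁻¹ P₁` of `t₁` with eigenvalues `(a, u, d)` — the `U(1)`-slot in the MIDDLE —, and the conjugations `ψ tᵢ = gᵢ (ψ t₁) gᵢ⁻¹`,
`ψ g = Tl g Tl⁻¹`, `g₂ = diag(π,1,1)`, `g₃`, `g₄` Flicker's conjugators).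

THE MATHEMATICS.  `κ_v(γ_H, t₁) = +1`: in the eigenframe the sign is `+1` iff the `H′_v`-length of the `u`-eigenvector is a unit norm (★ `finKappaAt_eq_ite_twistGram_eigenframe`);
that length is `(ᵗσ(Tl⁻¹P₁) H′ (Tl⁻¹P₁))₁₁ = (ᵗσP₁ Φ₃ P₁)₁₁ = 1` (★ `twistGram_formCongr`, ★ `twistGram_flickerFrame`).  For `i = 2, 3, 4`: by Rogawski's (4.3.2) in the frame
(★ `finKappaAt_conj_eq_iff_normTest`) `κ_v(γ_H, tᵢ) = κ_v(γ_H, t₁)` iff the MIDDLE norm test of the conjugator `Tl⁻¹ gᵢ Tl` passes, i.e. (transport by `Tl` again) iff the middle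
entry of the sign vector of `gᵢ` against `P₁` vanishes: `(1,0,1) ↦ 0` for `g₂ = diag(π,1,1)`, `(1,1,0) ↦ 1` for `g₃`, `(0,1,1) ↦ 1` for `g₄` (★ FILE 3
`normTest_diag_conj_iff`, `normTest_gThree_conj_iff`, `normTest_gFour_conj_iff`); since `κ_v = ±1` (★ `finKappaAt_eq_one_or_eq_neg_one_of_isUnit`) this gives
`(+1, +1, −1, −1)` (**`finKappaAt_flicker_representatives_eq`**).  HONEST LABEL: HC_CM is proved only modulo the printed citations until rung 0 closes; no letter here.

## References
* [Flicker1998UnitaryFL] Y. Z. Flicker, *Elementary proof of the fundamental lemma for a unitary group*, Canad. J. Math. 50 (1998), §2 Prop. 3 pp. 78–79, §5 p. 95.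
* [Rogawski1990] J. D. Rogawski, *Automorphic Representations of Unitary Groups in Three Variables* (1990), §3.5 Prop. 3.5.2 (c) p. 29, §4.3 (4.3.2) p. 43, §4.9 Prop. 4.9.1 p. 55.
-/

set_option autoImplicit false

noncomputable section

open NumberField IsDedekindDomain Matrix
open scoped MatrixGroups

namespace Literature.NumberTheory.Rogawski1990

open Literature.NumberTheory.Automorphic Literature.NumberTheory.Automorphic.UnitaryGroup

section Signs

variable (L : Type) [Field L] [NumberField L] [IsCMField L] (v : HeightOneSpectrum (𝓞 ↥(maximalRealSubfield L)))
  (H' : Matrix (Fin 3) (Fin 3) L)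
  (a : (UnitaryGroup.cmDatum L 2 (Matrix.of fun i j : Fin 2 => if i.val + j.val + 1 = 2 then (1 : L) else 0)).Local v ×
      (UnitaryGroup.cmDatum L 1 (Matrix.of fun i j : Fin 1 => if i.val + j.val + 1 = 1 then (1 : L) else 0)).Local v)
  (w : UnitaryGroup.PlacesOver L v) (hw : IsCMField.complexConj L • w.1 = w.1)

/-- `H′_v`-lengths against the frame `Tl⁻¹ X` are `Φ₃`-lengths against `X` when `ᵗσ(Tl) Φ₃ Tl = H′_v` (★ `twistGram_formCongr`). [cite: Flicker1998UnitaryFL, §2 p. 77] -/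
theorem twistGram_inv_mul_eq_of_formCongr {Tl : GL (Fin 3) (UnitaryGroup.LocalRing L v)}
    (hform : formCongr (UnitaryGroup.conjLocal L (IsCMField.complexConj L) v) Tl
        (Matrix.of fun i j : Fin 3 => if i.val + j.val + 1 = 3 then (1 : UnitaryGroup.LocalRing L v) else 0) =
      (UnitaryGroup.adelicForm L 3 H').map (UnitaryGroup.adeleToLocal L v))
    (X : Matrix (Fin 3) (Fin 3) (UnitaryGroup.LocalRing L v)) :
    twistGram (UnitaryGroup.conjLocal L (IsCMField.complexConj L) v) ((UnitaryGroup.adelicForm L 3 H').map (UnitaryGroup.adeleToLocal L v)) (Tl⁻¹.val * X) =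
      twistGram (UnitaryGroup.conjLocal L (IsCMField.complexConj L) v)
        (Matrix.of fun i j : Fin 3 => if i.val + j.val + 1 = 3 then (1 : UnitaryGroup.LocalRing L v) else 0) X := by
  rw [← hform, ← twistGram_formCongr, ← Matrix.mul_assoc, Units.mul_inv, Matrix.one_mul]

include hw in
open scoped Classical in
/-- **THE SIGNS `κ_v(γ_H, t₁…t₄) = (+1, +1, −1, −1)`** of four matched representatives in the position of ★ `exists_four_matched_flicker_representatives`: `t₁` with the
type-(1) frame `P = Tl⁻¹P₁` (eigenvalues `(a, u, d)`, `u` in the middle; `ᵗσ(Tl) Φ₃ Tl = H′_v`), and `Tl tᵢ Tl⁻¹ = gᵢ (Tl t₁ Tl⁻¹) gᵢ⁻¹` for Flicker's conjugators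
`g₂ = diag(π,1,1)`, `g₃`, `g₄` (`π` a `σ`-fixed non-norm, `2e = 1`, `x σx = 2`, `y σy = −2`). [cite: Flicker1998UnitaryFL, §2 Prop. 3 pp. 78–79; §5 p. 95]
[cite: Rogawski1990, §4.3 (4.3.2) p. 43; §3.5 Prop. 3.5.2 (c) p. 29; §4.9 Prop. 4.9.1 p. 55] -/
theorem finKappaAt_flicker_representatives_eq
    (hu : IsUnit ((finCharpolyTwo L v a).eval (finGammaTwo L v a)))
    (hH : (((UnitaryGroup.adelicForm L 3 H').map (UnitaryGroup.adeleToLocal L v)).map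
      (UnitaryGroup.conjLocal L (IsCMField.complexConj L) v))ᵀ = (UnitaryGroup.adelicForm L 3 H').map (UnitaryGroup.adeleToLocal L v))
    (hHd : IsUnit ((UnitaryGroup.adelicForm L 3 H').map (UnitaryGroup.adeleToLocal L v)).det)
    {e π x y a₁ d₁ : UnitaryGroup.LocalRing L v} (h2 : 2 * e = 1) (hσπ : UnitaryGroup.conjLocal L (IsCMField.complexConj L) v π = π)
    (hπN : ∀ z : UnitaryGroup.LocalRing L v, UnitaryGroup.conjLocal L (IsCMField.complexConj L) v z * z ≠ π)
    (hx : UnitaryGroup.conjLocal L (IsCMField.complexConj L) v x * x = 2) (hy : UnitaryGroup.conjLocal L (IsCMField.complexConj L) v y * y = -2)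
    {Tl P P₁ dπ g₃ g₄ : GL (Fin 3) (UnitaryGroup.LocalRing L v)}
    (hform : formCongr (UnitaryGroup.conjLocal L (IsCMField.complexConj L) v) Tl
        (Matrix.of fun i j : Fin 3 => if i.val + j.val + 1 = 3 then (1 : UnitaryGroup.LocalRing L v) else 0) =
      (UnitaryGroup.adelicForm L 3 H').map (UnitaryGroup.adeleToLocal L v))
    {t₁ t₂ t₃ t₄ : (UnitaryGroup.cmDatum L 3 H').Local v}
    (h₁ : IsLocalNormPair L H' v a t₁) (h₃ : IsLocalNormPair L H' v a t₃) (h₄ : IsLocalNormPair L H' v a t₄)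
    (hP : (t₁.val.val : Matrix (Fin 3) (Fin 3) (UnitaryGroup.LocalRing L v)) * P.val = P.val * diagonal ![a₁, finGammaTwo L v a, d₁])
    (hu' : Function.Injective ![a₁, finGammaTwo L v a, d₁])
    (hu'1 : ∀ i, UnitaryGroup.conjLocal L (IsCMField.complexConj L) v (![a₁, finGammaTwo L v a, d₁] i) * ![a₁, finGammaTwo L v a, d₁] i = 1)
    (hPP₁ : P = Tl⁻¹ * P₁) (hP₁ : P₁.val = !![1, 0, 1; 0, 1, 0; -1, 0, 1])
    (hdπ : dπ.val = !![π, 0, 0; 0, 1, 0; 0, 0, 1]) (hg₃ : g₃.val = !![e * π, π, -(e * π); e, 0, e; -e, 1, e])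
    (hg₄ : g₄.val = !![e * π, π, e * π; e, 0, -e; e, -1, e])
    (ht₂ : Tl * t₂.val * Tl⁻¹ = dπ * (Tl * t₁.val * Tl⁻¹) * dπ⁻¹) (ht₃ : Tl * t₃.val * Tl⁻¹ = g₃ * (Tl * t₁.val * Tl⁻¹) * g₃⁻¹)
    (ht₄ : Tl * t₄.val * Tl⁻¹ = g₄ * (Tl * t₁.val * Tl⁻¹) * g₄⁻¹) :
    finKappaAt L v H' a t₁ = 1 ∧ finKappaAt L v H' a t₂ = 1 ∧ finKappaAt L v H' a t₃ = -1 ∧ finKappaAt L v H' a t₄ = -1 := by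
  have hv : Subsingleton (UnitaryGroup.PlacesOver L v) :=
    UnitaryGroup.PlacesOver.subsingleton_of_smul_eq (IsCMField.complexConj L) (IsCMField.complexConj_ne_one L) w hw
  haveI : Algebra.IsQuadraticExtension ↥(maximalRealSubfield L) L := IsCMField.isQuadraticExtension L
  letI : Field (UnitaryGroup.LocalRing L v) :=
    (UnitaryGroup.LocalRing.isField_of_smul_eq (IsCMField.complexConj L) (IsCMField.complexConj_ne_one L) w hw).toField
  have h20 : (2 : UnitaryGroup.LocalRing L v) ≠ 0 := fun h0 => by
    have h1 := h2; rw [h0, zero_mul] at h1; exact zero_ne_one h1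
  have hj : ![a₁, finGammaTwo L v a, d₁] 1 = finGammaTwo L v a := rfl
  -- lengths against `P = Tl⁻¹ P₁` and against `Tl⁻¹ (g P₁)` are `Φ₃`-lengths
  have hPval : P.val = Tl⁻¹.val * P₁.val := by rw [hPP₁, Units.val_mul]
  have hmid : twistGram (UnitaryGroup.conjLocal L (IsCMField.complexConj L) v)
      (Matrix.of fun i j : Fin 3 => if i.val + j.val + 1 = 3 then (1 : UnitaryGroup.LocalRing L v) else 0) P₁.val 1 1 = 1 := by
    rw [hP₁, twistGram_flickerFrame (UnitaryGroup.conjLocal L (IsCMField.complexConj L) v) (θ := 1) (map_one _)]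
    rfl
  -- κ(t₁) = +1
  have hκ₁ : finKappaAt L v H' a t₁ = 1 := by
    rw [finKappaAt_eq_ite_twistGram_eigenframe L v H' a t₁ hv h₁ hu hP hj, if_pos]
    refine ⟨1, isUnit_one, ?_⟩
    rw [hPval, twistGram_inv_mul_eq_of_formCongr L v H' hform, hmid, map_one, mul_one]
  -- the conjugators `cᵢ = Tl⁻¹ gᵢ Tl` and their middle norm tests
  have conj : ∀ {g : GL (Fin 3) (UnitaryGroup.LocalRing L v)} {t : (UnitaryGroup.cmDatum L 3 H').Local v},
      Tl * t.val * Tl⁻¹ = g * (Tl * t₁.val * Tl⁻¹) * g⁻¹ → (Tl⁻¹ * g * Tl) * t₁.val * (Tl⁻¹ * g * Tl)⁻¹ = t.val := by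
    intro g t h
    have h' : t.val = Tl⁻¹ * (g * (Tl * t₁.val * Tl⁻¹) * g⁻¹) * Tl := by rw [← h]; group
    rw [h']; group
  have test : ∀ (g : GL (Fin 3) (UnitaryGroup.LocalRing L v)) (t : (UnitaryGroup.cmDatum L 3 H').Local v),
      Tl * t.val * Tl⁻¹ = g * (Tl * t₁.val * Tl⁻¹) * g⁻¹ →
      (finKappaAt L v H' a t = finKappaAt L v H' a t₁ ↔
        ∃ z : UnitaryGroup.LocalRing L v, IsUnit z ∧
          twistGram (UnitaryGroup.conjLocal L (IsCMField.complexConj L) v)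
              (Matrix.of fun i j : Fin 3 => if i.val + j.val + 1 = 3 then (1 : UnitaryGroup.LocalRing L v) else 0) (g.val * P₁.val) 1 1 =
            UnitaryGroup.conjLocal L (IsCMField.complexConj L) v z * z *
              twistGram (UnitaryGroup.conjLocal L (IsCMField.complexConj L) v)
                (Matrix.of fun i j : Fin 3 => if i.val + j.val + 1 = 3 then (1 : UnitaryGroup.LocalRing L v) else 0) P₁.val 1 1) := by
    intro g t h
    rw [finKappaAt_conj_eq_iff_normTest L v H' a t₁ t w hw h₁ hu hH hHd hP hu' hu'1 hj (conj h), hPval,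
      show (Tl⁻¹ * g * Tl).val * (Tl⁻¹.val * P₁.val) = Tl⁻¹.val * (g.val * P₁.val) by
        rw [Units.val_mul, Units.val_mul]; simp only [Matrix.mul_assoc]; rw [← Matrix.mul_assoc Tl.val, ← Units.val_mul, mul_inv_cancel, Units.val_one, Matrix.one_mul],
      twistGram_inv_mul_eq_of_formCongr L v H' hform, twistGram_inv_mul_eq_of_formCongr L v H' hform]
  have hκ₂ : finKappaAt L v H' a t₂ = 1 := by
    rw [← hκ₁]
    exact (test dπ t₂ ht₂).2 ((normTest_diag_conj_iff (UnitaryGroup.conjLocal L (IsCMField.complexConj L) v) hσπ hπN h20 hP₁ hdπ 1).2 (by decide))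
  have hκ₃ : finKappaAt L v H' a t₃ = -1 := by
    rcases finKappaAt_eq_one_or_eq_neg_one_of_isUnit L v H' a t₃ h₃ hu with h | h
    · exfalso
      have ht := (test g₃ t₃ ht₃).1 (h.trans hκ₁.symm)
      exact absurd ((normTest_gThree_conj_iff (UnitaryGroup.conjLocal L (IsCMField.complexConj L) v) h2 hσπ hπN hx h20 hP₁ hg₃ 1).1 ht) (by decide)
    · exact h
  have hκ₄ : finKappaAt L v H' a t₄ = -1 := by
    rcases finKappaAt_eq_one_or_eq_neg_one_of_isUnit L v H' a t₄ h₄ hu with h | h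
    · exfalso
      have ht := (test g₄ t₄ ht₄).1 (h.trans hκ₁.symm)
      exact absurd ((normTest_gFour_conj_iff (UnitaryGroup.conjLocal L (IsCMField.complexConj L) v) h2 hσπ hπN hy h20 hP₁ hg₄ 1).1 ht) (by decide)
    · exact h
  exact ⟨hκ₁, hκ₂, hκ₃, hκ₄⟩

end Signs

end Literature.NumberTheory.Rogawski1990

end
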